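import Mathlib
import HarnessLib
import Literature.AlgebraicGeometry.Resolution.KiralyLutkebohmert
import Literature.AlgebraicGeometry.Resolution.CobordantBlowupFiltration

/-!
# S1a — LINEAR RECOORDINATION: every LINEAR unipotent automorphism of a polynomial ring is of chain type in coordinates adapted to the image flag of `σ − 1`

[OURS · L1 W4.5c · lead-1 g14; plan-1 RULING R-F15h «I-6 := `linear_killsIn_one`: every datum whose σ is k-LINEAR … RECIPE (no Jordan theory): a basis ADAPTED TO
THE IMAGE FLAG V ⊋ NV ⊋ N²V ⊋ …, centre = the basis vectors of depth ≥ 1 with weights = depth, (T1) because N(N^jV) ⊆ N^{j+1}V, (T3) because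
gr N : N^{j−1}V/N^jV → N^jV/N^{j+1}V is surjective, (T2) because the augmentation ideal is generated by N(V); the recoordination is absorbed into e»] —
NOT statements of the manuscript; counted 0; AI-level work, weaker than expert review. Crux stmt-ResolutionOfSingularities-17941 `CyclicQuotientFourfolds`,
line `s1a-logminvertex` v13, instance programme (`stub_reachLowerInFX`). PURE LINEAR ALGEBRA, route-independent; consumed by `…S1aLinearKillsIn`.

* `exists_adapted` — ADAPTED BASES: for an antitone chain of subspaces `U 0 ≥ U 1 ≥ …` with `U r = ⊥`, a linearly independent subset of `U (r − d)` whose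
  part inside each `U i`, `i ≥ r − d`, spans `U i` (downward induction with `LinearIndepOn.extend`);
* `linForm_*`, `apply_linForm` — `ℓ(a) = Σ aᵢxᵢ = Fintype.linearCombination k X a` and `σ ℓ(a) = ℓ(aM)`; `mem_flag_iff`, `flag_*`,
  `vecMul_sub_one_mem_flag_succ`, `exists_vecMul_sub_one_eq_of_mem_flag_succ`, `flag_eq_bot` — the image flag `U j = range (a ↦ a(M−1)^j)` is descending
  from `⊤`, `N` raises the level, `gr N` is onto, and `U p = ⊥` when `σ^[p] = id` in characteristic `p`;
* ★★★ `exists_linearTriangularisation` — for a ring automorphism `σ` of `k[x_ι]` (`ι` finite, `char k = p`) fixing constants, LINEAR on the variables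
  (`σ xᵢ = Σⱼ Mᵢⱼ xⱼ`), of order dividing `p` (`σ^[p] = id`) and non-trivial: a finite set `s` of new variables, a ring isomorphism
  `α : k[X_s] ≃ k[x_ι]` fixing constants (the adapted basis as linear forms), the conjugate `σ' = α⁻¹ σ α`, and distinct centre variables `v : Fin c ↪ s`
  (`c > 0`) with positive weights `w` such that (T1) `σ' X_b − X_b ∈ 𝒥₁` for all `b` and `∈ 𝒥_{w l + 1}` for `b = v l`, (T2) `(X_{v l}) ≤ augIdeal σ'`,
  (T3) EXACT chains `σ' u − u = X_{v l}` with `u ∈ 𝒥_{w l − 1}` — the hypotheses of `triangular_killsIn_one` (`…S1aTriangularKillsIn`).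
-/

set_option linter.dupNamespace false

noncomputable section

open MvPolynomial Literature.AlgebraicGeometry.Resolution

namespace Summit.ResolutionOfSingularities.ResolutionOfSingularities.Theorems.WildQuotientResolution.S1.LinearKill

/-! ## Adapted bases of a finite descending chain of subspaces -/

section Flag

variable {k : Type} [Field k] {W : Type} [AddCommGroup W] [Module k W]

/-- **Adapted bases.** For an antitone chain `U` of subspaces with `U r = ⊥` and every `d`: a linearly independent `s ⊆ U (r − d)` such that for every
`i ≥ r − d` the part `s ∩ U i` spans `U i`. (Downward induction: extend the set obtained for `U (r − d)` inside `U (r − d − 1)`.) [folklore] -/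
theorem exists_adapted (U : ℕ → Submodule k W) (hU : Antitone U) {r : ℕ} (hr : U r = ⊥) (d : ℕ) :
    ∃ s : Set W, s ⊆ U (r - d) ∧ LinearIndepOn k id s ∧ ∀ i, r - d ≤ i → (U i : Set W) ⊆ Submodule.span k (s ∩ U i) := by
  induction d with
  | zero =>
    refine ⟨∅, Set.empty_subset _, linearIndepOn_empty k id, fun i hi x hx => ?_⟩
    have hi' : U i = ⊥ := le_bot_iff.mp (hr ▸ hU (by simpa using hi))
    rw [hi', SetLike.mem_coe, Submodule.mem_bot] at hx
    rw [hx]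
    exact Submodule.zero_mem _
  | succ d ih =>
    obtain ⟨s, hsU, hli, hspan⟩ := ih
    have hst : s ⊆ (U (r - (d + 1)) : Set W) := hsU.trans (hU (by omega))
    refine ⟨hli.extend hst, hli.extend_subset hst, hli.linearIndepOn_extend hst, fun i hi => ?_⟩
    by_cases hi' : r - d ≤ i
    · exact (hspan i hi').trans (Submodule.span_mono (Set.inter_subset_inter_left _ (hli.subset_extend hst)))
    · obtain rfl : i = r - (d + 1) := by omega
      refine (hli.subset_span_extend hst).trans (Submodule.span_mono fun y hy => ⟨hy, hli.extend_subset hst hy⟩)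

end Flag

/-! ## Linear forms and the image flag of a linear automorphism of `k[x_ι]` -/

section Linear

variable {k : Type} [Field k] {ι : Type} [Fintype ι] [DecidableEq ι]

omit [DecidableEq ι] in
/-- The linear form of a coefficient vector: `ℓ(a) = Σ aᵢ xᵢ` (`ℓ = Fintype.linearCombination k X`). -/
theorem linForm_apply (a : ι → k) : Fintype.linearCombination k (X : ι → MvPolynomial ι k) a = ∑ i, a i • X i := Fintype.linearCombination_apply _ _ _

/-- `ℓ(eᵢ) = xᵢ`. -/
theorem linForm_single (i : ι) : Fintype.linearCombination k (X : ι → MvPolynomial ι k) (Pi.single i 1) = X i := by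
  rw [Fintype.linearCombination_apply_single, one_smul]

omit [DecidableEq ι] in
/-- `ℓ` is injective (the variables are linearly independent). -/
theorem linForm_injective : Function.Injective (Fintype.linearCombination k (X : ι → MvPolynomial ι k)) := by
  intro a b h
  have h0 : ∑ i, (a - b) i • (X i : MvPolynomial ι k) = 0 := by
    simp only [Pi.sub_apply, sub_smul, Finset.sum_sub_distrib]
    rw [← linForm_apply, ← linForm_apply, h, sub_self]
  funext i
  exact sub_eq_zero.mp (Fintype.linearIndependent_iff.mp (linearIndependent_X (R := k) ι) (a - b) h0 i)

/-- The IMAGE FLAG `U j = {a (M − 1)^j}` of `N = M − 1` acting on coefficient (row) vectors is `LinearMap.range (Matrix.vecMulLinear ((M - 1) ^ j))`;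
membership unfolded. -/
theorem mem_flag_iff {M : Matrix ι ι k} {j : ℕ} {x : ι → k} :
    x ∈ LinearMap.range (Matrix.vecMulLinear ((M - 1) ^ j)) ↔ ∃ a, Matrix.vecMul a ((M - 1) ^ j) = x := by
  simp

/-- `U 0 = ⊤`. -/
theorem flag_zero (M : Matrix ι ι k) : LinearMap.range (Matrix.vecMulLinear ((M - 1) ^ 0)) = (⊤ : Submodule k (ι → k)) := by
  ext x
  rw [mem_flag_iff]
  simp only [pow_zero, Matrix.vecMul_one, exists_eq, Submodule.mem_top]

/-- The image flag is descending. -/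
theorem flag_antitone (M : Matrix ι ι k) : Antitone fun j : ℕ => LinearMap.range (Matrix.vecMulLinear ((M - 1) ^ j)) := by
  refine antitone_nat_of_succ_le fun j x hx => ?_
  obtain ⟨a, rfl⟩ := mem_flag_iff.mp hx
  exact mem_flag_iff.mpr ⟨Matrix.vecMul a (M - 1), by rw [Matrix.vecMul_vecMul, ← pow_succ']⟩

/-- `N` raises the level: `x ∈ U j ⇒ x(M − 1) ∈ U (j+1)`. -/
theorem vecMul_sub_one_mem_flag_succ {M : Matrix ι ι k} {j : ℕ} {x : ι → k} (hx : x ∈ LinearMap.range (Matrix.vecMulLinear ((M - 1) ^ j))) :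
    Matrix.vecMul x (M - 1) ∈ LinearMap.range (Matrix.vecMulLinear ((M - 1) ^ (j + 1))) := by
  obtain ⟨a, rfl⟩ := mem_flag_iff.mp hx
  exact mem_flag_iff.mpr ⟨a, by rw [Matrix.vecMul_vecMul, ← pow_succ]⟩

/-- `gr N` is onto: `x ∈ U (j+1) ⇒ x = a(M − 1)` with `a ∈ U j`. -/
theorem exists_vecMul_sub_one_eq_of_mem_flag_succ {M : Matrix ι ι k} {j : ℕ} {x : ι → k}
    (hx : x ∈ LinearMap.range (Matrix.vecMulLinear ((M - 1) ^ (j + 1)))) :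
    ∃ a ∈ LinearMap.range (Matrix.vecMulLinear ((M - 1) ^ j)), Matrix.vecMul a (M - 1) = x := by
  obtain ⟨a, rfl⟩ := mem_flag_iff.mp hx
  exact ⟨Matrix.vecMul a ((M - 1) ^ j), mem_flag_iff.mpr ⟨a, rfl⟩, by rw [Matrix.vecMul_vecMul, ← pow_succ]⟩

variable (σ : MvPolynomial ι k ≃+* MvPolynomial ι k) (hC : ∀ a : k, σ (C a) = C a)
  (M : Matrix ι ι k) (hM : ∀ i, σ (X i) = ∑ j, M i j • X j)
include hC hM

omit [DecidableEq ι] in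
/-- **`σ` acts on linear forms by the matrix**: `σ(ℓ(a)) = ℓ(a M)`. -/
theorem apply_linForm (a : ι → k) : σ (Fintype.linearCombination k (X : ι → MvPolynomial ι k) a) = Fintype.linearCombination k (X : ι → MvPolynomial ι k) (Matrix.vecMul a M) := by
  rw [linForm_apply, linForm_apply, map_sum]
  have h1 : ∀ i, σ (a i • (X i : MvPolynomial ι k)) = ∑ j, (a i * M i j) • (X j : MvPolynomial ι k) := fun i => by
    rw [smul_eq_C_mul, map_mul, hC, hM, Finset.mul_sum]
    refine Finset.sum_congr rfl fun j _ => ?_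
    rw [smul_eq_C_mul, smul_eq_C_mul, ← mul_assoc, ← C_mul]
  simp_rw [h1]
  rw [Finset.sum_comm]
  refine Finset.sum_congr rfl fun j _ => ?_
  rw [← Finset.sum_smul]
  rfl

/-- Iterates: `σ^[n](ℓ(a)) = ℓ(a Mⁿ)`. -/
theorem iterate_apply_linForm (n : ℕ) (a : ι → k) :
    (⇑σ)^[n] (Fintype.linearCombination k (X : ι → MvPolynomial ι k) a) = Fintype.linearCombination k (X : ι → MvPolynomial ι k) (Matrix.vecMul a (M ^ n)) := by
  induction n generalizing a with
  | zero => rw [Function.iterate_zero, id, pow_zero, Matrix.vecMul_one]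
  | succ n ih => rw [Function.iterate_succ_apply, apply_linForm σ hC M hM, ih, Matrix.vecMul_vecMul, ← pow_succ']

/-- **Nilpotency**: if `σ^[p] = id` in characteristic `p` then `U p = ⊥` (`(M − 1)^p = M^p − 1` and `ℓ(aM^p) = σ^[p]ℓ(a) = ℓ(a)`). -/
theorem flag_eq_bot {p : ℕ} [Fact p.Prime] [CharP k p] (hσp : ∀ y, (⇑σ)^[p] y = y) (hne : Nonempty ι) :
    LinearMap.range (Matrix.vecMulLinear ((M - 1) ^ p)) = ⊥ := by
  rw [eq_bot_iff]
  intro x hx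
  obtain ⟨a, rfl⟩ := mem_flag_iff.mp hx
  rw [Submodule.mem_bot, sub_pow_char_of_commute p (Commute.one_right M), one_pow, Matrix.vecMul_sub, Matrix.vecMul_one, sub_eq_zero]
  apply linForm_injective
  rw [← iterate_apply_linForm σ hC M hM, hσp]

end Linear

/-! ## The linear triangularisation -/

section Main

variable {k : Type} [Field k] {ι : Type} [Fintype ι] [DecidableEq ι]

/-- ★★★ **LINEAR TRIANGULARISATION (no Jordan theory).** Let `σ` be a ring automorphism of `k[x_ι]` (`ι` finite, `char k = p` prime) fixing constants and LINEAR on the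
variables with matrix `M` (`σ xᵢ = Σⱼ Mᵢⱼ xⱼ`), with `σ^[p] = id` and `σ xᵢ ≠ xᵢ` for some `i`. Then there are: a finite set `s ⊆ k^ι` (an adapted basis of the image
flag of `M − 1`, read as new variables), a ring isomorphism `α : k[X_s] ≃ k[x_ι]` fixing constants, a ring automorphism `σ'` of `k[X_s]` with `α ∘ σ' = σ ∘ α`,
distinct centre variables `v : Fin c → s` (`c > 0`, injective) with positive weights `w`, such that, for the weighted filtration `𝒥` of `(X ∘ v, w)`:
(T1) `σ' X_b − X_b ∈ 𝒥₁` for every `b ∈ s` and `σ' X_{v l} − X_{v l} ∈ 𝒥_{w l + 1}`; (T2) `(X_{v l} : l) ≤ augIdeal σ'`; (T3) for every `l` some `u ∈ 𝒥_{w l − 1}` with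
`σ' u − u = X_{v l}` (exact chains). [OURS · L1 W4.5c · R-F15h I-6; NOT a statement of the manuscript] -/
theorem exists_linearTriangularisation {p : ℕ} [Fact p.Prime] [CharP k p]
    (σ : MvPolynomial ι k ≃+* MvPolynomial ι k) (hC : ∀ a : k, σ (C a) = C a)
    (M : Matrix ι ι k) (hM : ∀ i, σ (X i) = ∑ j, M i j • X j) (hσp : ∀ y, (⇑σ)^[p] y = y) (hne : ∃ i, σ (X i) ≠ X i) :
    ∃ (s : Set (ι → k)) (_ : Fintype s) (α : MvPolynomial s k ≃+* MvPolynomial ι k) (σ' : MvPolynomial s k ≃+* MvPolynomial s k)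
      (c : ℕ) (v : Fin c → s) (w : Fin c → ℕ),
      (∀ a : k, α (C a) = C a) ∧ (∀ y, α (σ' y) = σ (α y)) ∧ (∀ a : k, σ' (C a) = C a) ∧ 0 < c ∧ Function.Injective v ∧ (∀ l, 0 < w l) ∧
      (∀ b : s, σ' (X b) - X b ∈ (weightedFiltration (X ∘ v : Fin c → MvPolynomial s k) w).ideal 1) ∧
      (∀ l, σ' (X (v l)) - X (v l) ∈ (weightedFiltration (X ∘ v : Fin c → MvPolynomial s k) w).ideal (w l + 1)) ∧
      Ideal.span (Set.range (X ∘ v : Fin c → MvPolynomial s k)) ≤ augmentationIdeal σ' ∧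
      (∀ l, ∃ u : MvPolynomial s k, u ∈ (weightedFiltration (X ∘ v : Fin c → MvPolynomial s k) w).ideal (w l - 1) ∧ σ' u - u = X (v l)) := by
  classical
  obtain ⟨i₀, hi₀⟩ := hne
  haveI : Nonempty ι := ⟨i₀⟩
  -- the image flag and an adapted basis of `k^ι`
  let U : ℕ → Submodule k (ι → k) := fun j => LinearMap.range (Matrix.vecMulLinear ((M - 1) ^ j))
  have hU : Antitone U := flag_antitone M
  have hUp : U p = ⊥ := flag_eq_bot σ hC M hM hσp ⟨i₀⟩
  have hU0 : U 0 = ⊤ := flag_zero M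
  obtain ⟨s, -, hli, hspan⟩ := exists_adapted U hU hUp p
  have hspan' : ∀ i, (U i : Set (ι → k)) ⊆ Submodule.span k (s ∩ U i) := fun i => hspan i (by omega)
  have hfin : s.Finite := hli.linearIndependent.set_finite_of_isNoetherian
  haveI : Fintype s := hfin.fintype
  have htop : ⊤ ≤ Submodule.span k (Set.range fun b : s => (b : ι → k)) := by
    rw [Subtype.range_coe_subtype, Set.setOf_mem_eq]
    intro x _
    exact Submodule.span_mono Set.inter_subset_left (hspan' 0 (by rw [hU0]; trivial))
  let B : Module.Basis s k (ι → k) := Module.Basis.mk hli.linearIndependent htop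
  have hB : ∀ b : s, B b = b := fun b => Module.Basis.mk_apply _ _ _
  have hb0 : ∀ b : s, (b : ι → k) ≠ 0 := fun b => by rw [← hB]; exact B.ne_zero b
  -- depth: the largest `j ≤ p` with `b ∈ U j`
  let dp : s → ℕ := fun b => Nat.findGreatest (fun j => (b : ι → k) ∈ U j) p
  have hmem_dp : ∀ b : s, (b : ι → k) ∈ U (dp b) := fun b =>
    Nat.findGreatest_spec (P := fun j => (b : ι → k) ∈ U j) (Nat.zero_le p) (by rw [hU0]; trivial)
  have hle_dp : ∀ (b : s) {j : ℕ}, (b : ι → k) ∈ U j → j ≤ dp b := by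
    intro b j hj
    by_cases hjr : j ≤ p
    · exact Nat.le_findGreatest (P := fun j => (b : ι → k) ∈ U j) hjr hj
    · exfalso
      have : U j ≤ U p := hU (by omega)
      rw [hUp, le_bot_iff] at this
      rw [this, Submodule.mem_bot] at hj
      exact hb0 b hj
  -- the support of an element of `U j` in the basis `B` consists of vectors of depth `≥ j`
  have hsupp : ∀ {j : ℕ} {x : ι → k}, x ∈ U j → ∀ b ∈ (B.repr x).support, j ≤ dp b := by
    intro j x hx b hb
    have hx' : x ∈ Submodule.span k (B '' {b : s | (b : ι → k) ∈ U j}) := by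
      have himg : B '' {b : s | (b : ι → k) ∈ U j} = s ∩ U j := by
        ext y
        simp only [Set.mem_image, Set.mem_setOf_eq, hB, Set.mem_inter_iff, SetLike.mem_coe]
        constructor
        · rintro ⟨b, hb, rfl⟩; exact ⟨b.2, hb⟩
        · rintro ⟨hy, hyU⟩; exact ⟨⟨y, hy⟩, hyU, rfl⟩
      rw [himg]
      exact hspan' j hx
    exact hle_dp b (B.mem_span_image.mp hx' hb)
  -- the centre: basis vectors of positive depth, enumerated
  let S₁ : Finset s := Finset.univ.filter fun b => 1 ≤ dp b
  let c : ℕ := S₁.card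
  let v : Fin c → s := fun l => (S₁.equivFin.symm l : s)
  have hvS : ∀ l, v l ∈ S₁ := fun l => (S₁.equivFin.symm l).2
  have hv : Function.Injective v := fun l l' h => S₁.equivFin.symm.injective (Subtype.ext h)
  let w : Fin c → ℕ := fun l => dp (v l)
  have hw : ∀ l, 0 < w l := fun l => (Finset.mem_filter.mp (hvS l)).2
  -- every basis vector of depth `≥ 1` is a centre variable
  have hXmem : ∀ (b : s) {j : ℕ}, 1 ≤ j → j ≤ dp b →
      (X b : MvPolynomial s k) ∈ (weightedFiltration (X ∘ v : Fin c → MvPolynomial s k) w).ideal j := by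
    intro b j hj hjb
    have hbS : b ∈ S₁ := Finset.mem_filter.mpr ⟨Finset.mem_univ _, hj.trans hjb⟩
    let l : Fin c := S₁.equivFin ⟨b, hbS⟩
    have hvl : v l = b := by
      change ((S₁.equivFin.symm (S₁.equivFin ⟨b, hbS⟩)) : s) = b
      rw [Equiv.symm_apply_apply]
    have h1 : (X b : MvPolynomial s k) = (X ∘ v) l := by rw [Function.comp_apply, hvl]
    rw [h1]
    refine (weightedFiltration _ w).antitone ?_ (mem_weightedFiltration_ideal (X ∘ v : Fin c → MvPolynomial s k) w l)
    change j ≤ dp (v l)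
    rw [hvl]; exact hjb
  -- the linear lift `L(x) = Σ_b (B-coordinates of x)_b X_b` and its filtration level
  let L : (ι → k) →ₗ[k] MvPolynomial s k := (Finsupp.linearCombination k (X : s → MvPolynomial s k)) ∘ₗ B.repr.toLinearMap
  have hL : ∀ x, L x = (B.repr x).sum fun b a => a • X b := fun x => Finsupp.linearCombination_apply _ _
  have hLb : ∀ b : s, L b = X b := fun b => by
    rw [hL, ← hB b, B.repr_self, Finsupp.sum_single_index (h := fun b' a => a • (X b' : MvPolynomial s k)) (zero_smul _ _), one_smul]
  have hLmem : ∀ {j : ℕ} {x : ι → k}, x ∈ U j → L x ∈ (weightedFiltration (X ∘ v : Fin c → MvPolynomial s k) w).ideal j := by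
    intro j x hx
    rcases Nat.eq_zero_or_pos j with rfl | hj
    · rw [(weightedFiltration _ w).ideal_zero]; trivial
    rw [hL, Finsupp.sum]
    refine Ideal.sum_mem _ fun b hb => ?_
    rw [smul_eq_C_mul]
    exact Ideal.mul_mem_left _ _ (hXmem b hj (hsupp hx b hb))
  -- the recoordination `α : k[X_s] ≃ k[x_ι]`, `X_b ↦ ℓ(b)`
  let φ : MvPolynomial s k →ₐ[k] MvPolynomial ι k := aeval fun b : s => Fintype.linearCombination k (X : ι → MvPolynomial ι k) b
  let ψ : MvPolynomial ι k →ₐ[k] MvPolynomial s k := aeval fun i : ι => L (Pi.single i 1)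
  have hφL : ∀ x, φ (L x) = Fintype.linearCombination k (X : ι → MvPolynomial ι k) x := by
    intro x
    have key : φ.toLinearMap ∘ₗ L = Fintype.linearCombination k (X : ι → MvPolynomial ι k) := B.ext fun b => by
      rw [LinearMap.comp_apply, AlgHom.toLinearMap_apply, hB, hLb]
      exact aeval_X _ b
    exact LinearMap.congr_fun key x
  have hψℓ : ∀ x, ψ (Fintype.linearCombination k (X : ι → MvPolynomial ι k) x) = L x := by
    intro x
    have key : ψ.toLinearMap ∘ₗ Fintype.linearCombination k (X : ι → MvPolynomial ι k) = L := (Pi.basisFun k ι).ext fun i => by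
      rw [LinearMap.comp_apply, AlgHom.toLinearMap_apply, Pi.basisFun_apply, linForm_single]
      exact aeval_X _ i
    exact LinearMap.congr_fun key x
  have hφψ : φ.comp ψ = AlgHom.id k _ := algHom_ext fun i => by
    rw [AlgHom.comp_apply, AlgHom.id_apply]
    change φ (aeval (fun i : ι => L (Pi.single i 1)) (X i)) = X i
    rw [aeval_X, hφL, linForm_single]
  have hψφ : ψ.comp φ = AlgHom.id k _ := algHom_ext fun b => by
    rw [AlgHom.comp_apply, AlgHom.id_apply]
    change ψ (aeval (fun b : s => Fintype.linearCombination k (X : ι → MvPolynomial ι k) b) (X b)) = X b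
    rw [aeval_X, hψℓ, hLb]
  let αA : MvPolynomial s k ≃ₐ[k] MvPolynomial ι k := AlgEquiv.ofAlgHom φ ψ hφψ hψφ
  let α : MvPolynomial s k ≃+* MvPolynomial ι k := αA.toRingEquiv
  have hαφ : ∀ y, α y = φ y := fun _ => rfl
  have hαψ : ∀ y, α.symm y = ψ y := fun _ => rfl
  let σ' : MvPolynomial s k ≃+* MvPolynomial s k := α.trans (σ.trans α.symm)
  have hσ' : ∀ y, σ' y = α.symm (σ (α y)) := fun _ => rfl
  -- `σ'` on the linear lifts: `σ'(L x) = L(x M)`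
  have hσ'L : ∀ x, σ' (L x) = L (Matrix.vecMul x M) := fun x => by
    rw [hσ', hαφ, hφL, apply_linForm σ hC M hM, hαψ, hψℓ]
  have hσ'L' : ∀ x, σ' (L x) - L x = L (Matrix.vecMul x (M - 1)) := fun x => by
    rw [hσ'L, Matrix.vecMul_sub, Matrix.vecMul_one, map_sub]
  have hσ'X : ∀ b : s, σ' (X b) - X b = L (Matrix.vecMul (b : ι → k) (M - 1)) := fun b => by rw [← hLb, hσ'L']
  -- (T3) exact chains, and `c > 0`
  have hchain : ∀ l, ∃ u : MvPolynomial s k,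
      u ∈ (weightedFiltration (X ∘ v : Fin c → MvPolynomial s k) w).ideal (w l - 1) ∧ σ' u - u = X (v l) := by
    intro l
    obtain ⟨j, hj⟩ : ∃ j, w l = j + 1 := ⟨w l - 1, (Nat.succ_pred_eq_of_pos (hw l)).symm⟩
    have hmem : ((v l : s) : ι → k) ∈ U (j + 1) := by rw [← hj]; exact hmem_dp (v l)
    obtain ⟨a, ha, hax⟩ := exists_vecMul_sub_one_eq_of_mem_flag_succ hmem
    refine ⟨L a, ?_, ?_⟩
    · rw [hj, Nat.add_sub_cancel]; exact hLmem ha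
    · rw [hσ'L', hax, hLb]
  refine ⟨s, inferInstance, α, σ', c, v, w, fun a => ?_, fun y => ?_, fun a => ?_, ?_, hv, hw, fun b => ?_, fun l => ?_, ?_, hchain⟩
  · rw [hαφ]; exact φ.commutes a
  · rw [hσ', α.apply_symm_apply]
  · have h1 : φ (C a) = C a := φ.commutes a
    have h2 : ψ (C a) = C a := ψ.commutes a
    rw [hσ', hαφ, h1, hC, hαψ, h2]
  · -- `c > 0`: otherwise `U 1 = ⊥`, i.e. `M = 1`, contradicting `σ x_{i₀} ≠ x_{i₀}`
    by_contra hc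
    have hc0 : S₁ = ∅ := Finset.card_eq_zero.mp (by omega)
    apply hi₀
    have hrow : Matrix.vecMul (Pi.single i₀ (1 : k)) (M - 1) = 0 := by
      have h0mem : (Pi.single i₀ (1 : k)) ∈ U 0 := by rw [hU0]; trivial
      have hmem : Matrix.vecMul (Pi.single i₀ (1 : k)) (M - 1) ∈ U 1 := vecMul_sub_one_mem_flag_succ h0mem
      have hsub : (U 1 : Set (ι → k)) ⊆ Submodule.span k (s ∩ U 1) := hspan' 1
      have hempty : s ∩ (U 1 : Set (ι → k)) = ∅ := by
        apply Set.eq_empty_iff_forall_notMem.mpr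
        rintro y ⟨hy, hyU⟩
        have hb : (⟨y, hy⟩ : s) ∈ S₁ := Finset.mem_filter.mpr ⟨Finset.mem_univ _, hle_dp ⟨y, hy⟩ hyU⟩
        rw [hc0] at hb
        exact Finset.notMem_empty _ hb
      have := hsub hmem
      rw [hempty, Submodule.span_empty] at this
      exact (Submodule.mem_bot k).mp this
    have h1 : Matrix.vecMul (Pi.single i₀ (1 : k)) M = Pi.single i₀ 1 := by
      rw [Matrix.vecMul_sub, Matrix.vecMul_one, sub_eq_zero] at hrow
      exact hrow
    rw [← linForm_single, apply_linForm σ hC M hM, h1]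
  · -- (T1) for every variable
    rw [hσ'X]
    refine hLmem ?_
    exact hU (by omega : 1 ≤ dp b + 1) (vecMul_sub_one_mem_flag_succ (hmem_dp b))
  · -- (T1) for centre variables
    rw [hσ'X]
    exact hLmem (vecMul_sub_one_mem_flag_succ (hmem_dp (v l)))
  · -- (T2) isolation from the exact chains
    rw [Ideal.span_le]
    rintro _ ⟨l, rfl⟩
    obtain ⟨u, -, hu⟩ := hchain l
    rw [SetLike.mem_coe, Function.comp_apply, ← hu]
    exact sub_mem_augmentationIdeal σ' u

end Main

end Summit.ResolutionOfSingularities.ResolutionOfSingularities.Theorems.WildQuotientResolution.S1.LinearKill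

end
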